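import Literature.AnabelianGeometry.AbsoluteAnabelian.AbsTopII.InertiaDecompositionProofs

/-!
# [AbsTopII] Prop 1.3 (v): the input «(iv) at open subgroups» REDUCED to a centraliser-of-inertia statement inside `Π_𝔾`

S. Mochizuki, *Topics in Absolute Anabelian Geometry II* [AbsTopII] (bib `MochizukiAbsTopII2013`;
locators = PDF pages of the kurims manuscript `paper:url-585b8d0ad0d9`), §1, Def 1.2 (ii) p. 10,
Proposition 1.3 (iii)/(iv)/(v) pp. 11–12, proof of (v) p. 16.

The cell proves Prop 1.3 (v) as typed (`DPSCData.Prop13v`, FACT-LIST F-0278, abc-iut-L4-t4) from its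
printed inputs in `DPSCData.prop13v_of_inputs` (`AbsTopII/InertiaDecompositionProofs.lean`, p425615;
sub-DAG `plan/L4/SUBDAG-AbsTopII-Prop13.md`).  Besides [CombGC] Prop 1.2 (i)(ii) and the graphicity of
the outer `H`-action, that theorem carries ONE input which is not a [CombGC] statement, row P13/I-L —
the first sentence of the printed proof of (v), p. 16: "it follows from assertion (iv) [i.e., by
applying assertion (iv) to various open subgroups of `Π_H`, `Π_I` — cf. also Remark 1.2.1] that if, for
`γ ∈ Π_H`, `I_v ∩ (γ·I_v·γ⁻¹) ≠ {1}`, then `Π_v = γ·Π_v·γ⁻¹`" — typed verbatim as the hypothesis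
`hL : ∀ v g, I_v ⊓ g·I_v·g⁻¹ ≠ ⊥ → g·Π_v·g⁻¹ = Π_v` over ALL `g ∈ Π_H`.

This PROOF-ONLY file (no definitions) shows by pure group theory that, GIVEN the graphicity input
(I-GR) and the typed rows Prop 1.3 (iv) ["in particular" clause, `Π_𝔾`-scope: `DPSCData.Prop13iv'`,
second conjunct] and Prop 1.3 (iii) [`I_v ∩ Π_𝔾 = {1}`: `DPSCData.Prop13iii`, first conjunct], the
`Π_H`-level input I-L is EQUIVALENT to a statement that lives entirely inside `Π_I ⊇ Π_𝔾` and mentions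
no `Π_H`-conjugate:

  (I-Z)  for every vertex `v` and every inertia element `1 ≠ x ∈ I_v = Z_{Π_I}(Π_v)`:
         `Z_{Π_𝔾}(x) ⊆ D_v` (equivalently `Z_{Π_𝔾}(x) ⊆ Π_v`, as `D_v ∩ Π_𝔾 = Π_v`),

i.e. "an element of `Π_𝔾` commuting with a nontrivial inertia element at `v` normalises `Π_v`":

* `DPSCData.conj_smul_Iv` — `g·I_v·g⁻¹ = Z_{Π_I}(g·Π_v·g⁻¹)` (`Π_I ⊴ Π_H`), hence the inertia groups
  of `Π_𝔾`-conjugate verticial subgroups are the `Π_𝔾`-conjugates (`conj_smul_Iv_eq_of_conj_smul_vertSub_eq`);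
* `DPSCData.inputL_of_graphic` — I-L ⟸ I-GR ∧ (iv′).2 ∧ I-L restricted to `γ ∈ Π_𝔾` (graphicity moves
  `g·Π_v·g⁻¹` to `γ·Π_{v'}·γ⁻¹`, (iv′) forces `v' = v`);
* `DPSCData.exists_comm_of_Iv_inf_conj_ne_bot` — for `γ ∈ Π_𝔾`, a nontrivial element of
  `I_v ∩ γ·I_v·γ⁻¹` COMMUTES with `γ` (two elements of `I_v` congruent mod `Π_𝔾` are equal, by (iii));
* `DPSCData.inputLG_of_centralizer_le_Dv` / `centralizer_inf_PiG_le_Dv_of_inputLG` — the `Π_𝔾`-scope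
  form of I-L is equivalent to I-Z (⟸ uses (iii), ⟹ is free);
* `DPSCData.prop13v_of_prop13iii_prop13iv'` — **Prop 1.3 (v) (F-0278) from the typed (iii), (iv′),
  [CombGC] Prop 1.2 (i)(ii), graphicity, I-Z and `I_v` infinite**; and the `DPSCIndexData` form with
  `I_v` infinite read from `Prop_1_3_iii'` (`I_v ≅ Ẑ^Σ`).

So the residual input of row P13/v beyond typed rows and [CombGC]/graphicity inputs is the single
`Π_𝔾`-internal statement I-Z — in print a consequence of (iv) for the finite étale coverings of
Remark 1.2.1 (geometric; not derivable from the abstract data, and NOT asserted here).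
HONEST FRAMING: classical group theory over a typed interface of a refereed, undisputed paper; the
geometric inputs stay hypotheses (typed ≠ proved); nothing here bears on [IUTchIII] Cor 3.12.
-/

open scoped Pointwise

namespace Literature.AnabelianGeometry.AbsoluteAnabelian

universe u

/-! ## Generic group theory: conjugation versus centralisers and normalisers -/

section GroupTheory

variable {G : Type u} [Group G]

/-- `g·Z(K)·g⁻¹ = Z(g·K·g⁻¹)` (the inertia group of a conjugate is the conjugate of the inertia group;
private twin of the lemma of the same name in `DecompositionGroupsProp13ivBridge.lean`, kept
build-independent). [cite: MochizukiAbsTopII2013, Def 1.2 (ii) p.10] -/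
private theorem conj_smul_centralizer_eq (g : G) (K : Subgroup G) :
    MulAut.conj g • Subgroup.centralizer (K : Set G) =
      Subgroup.centralizer ((MulAut.conj g • K : Subgroup G) : Set G) := by
  ext x
  rw [Subgroup.mem_pointwise_smul_iff_inv_smul_mem, Subgroup.mem_centralizer_iff,
    Subgroup.mem_centralizer_iff]
  constructor
  · intro h m hm
    rw [SetLike.mem_coe, Subgroup.mem_pointwise_smul_iff_inv_smul_mem] at hm
    have e := h _ hm
    rw [← smul_mul', ← smul_mul'] at e
    exact MulAction.injective _ e
  · intro h k hk
    have e := h (MulAut.conj g • k) (Subgroup.smul_mem_pointwise_smul _ _ _ hk)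
    apply MulAction.injective (MulAut.conj g)
    simp only [smul_mul', smul_inv_smul]
    exact e

/-- `g ∈ N_G(H)` iff `g·H·g⁻¹ = H` (pointwise `MulAut.conj` form of Def 1.2 (ii) "`D_v := N_{Π_H}(Π_v)`";
private twin of abc-iut-L6's `mem_normalizer_iff_conj_smul_eq`, kept build-independent).
[cite: MochizukiAbsTopII2013, Def 1.2 (ii) p.10] -/
private theorem mem_normalizer_iff_conj_smul_eq' (g : G) (H : Subgroup G) :
    g ∈ Subgroup.normalizer (H : Set G) ↔ MulAut.conj g • H = H := by
  rw [Subgroup.mem_normalizer_iff]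
  constructor
  · intro h
    ext x
    rw [Subgroup.mem_pointwise_smul_iff_inv_smul_mem, ← map_inv, MulAut.smul_def,
      MulAut.conj_apply, inv_inv, h (g⁻¹ * x * g)]
    simp only [mul_assoc, mul_inv_cancel_left, mul_inv_cancel, mul_one]
  · intro h x
    conv_rhs => rw [← h]
    rw [← MulAut.conj_apply, ← MulAut.smul_def, Subgroup.smul_mem_pointwise_smul_iff]

end GroupTheory

namespace DPSCData

variable (X : DPSCData.{u})

/-! ## Inertia groups of conjugate verticial subgroups -/

/-- `g·I_v·g⁻¹ = Z_{Π_I}(g·Π_v·g⁻¹)`: conjugation by `g ∈ Π_H` carries `I_v = Z_{Π_I}(Π_v)` to the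
"`I_v`" of the conjugate verticial subgroup `g·Π_v·g⁻¹`, the subgroup `Π_I ⊆ Π_H` being normal ("`I` is
normal in `H`", proof of (v) p. 16). [cite: MochizukiAbsTopII2013, Prop 1.3 (v) p.16] -/
theorem conj_smul_Iv (v : X.Vert) (g : X.PiH) :
    MulAut.conj g • X.Iv v =
      Subgroup.centralizer ((MulAut.conj g • X.vertSub v : Subgroup X.PiH) : Set X.PiH) ⊓ X.PiI := by
  haveI : X.PiI.Normal := X.normal_PiI
  unfold DPSCData.Iv
  rw [Subgroup.smul_inf, conj_smul_centralizer_eq, Subgroup.Normal.conj_smul_eq_self g X.PiI]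

/-- Transport of inertia groups along graphicity: if `g·Π_v·g⁻¹ = γ·Π_{v'}·γ⁻¹` then
`g·I_v·g⁻¹ = γ·I_{v'}·γ⁻¹`. [cite: MochizukiAbsTopII2013, Prop 1.3 (v) p.16] -/
theorem conj_smul_Iv_eq_of_conj_smul_vertSub_eq {v v' : X.Vert} {g γ : X.PiH}
    (h : MulAut.conj g • X.vertSub v = MulAut.conj γ • X.vertSub v') :
    MulAut.conj g • X.Iv v = MulAut.conj γ • X.Iv v' := by
  rw [conj_smul_Iv, conj_smul_Iv, h]

/-! ## I-L from graphicity, (iv′) and its `Π_𝔾`-scope restriction -/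

/-- **Row P13/I-L reduced to `Π_𝔾`-scope.**  "if, for `γ ∈ Π_H`, `I_v ∩ (γ·I_v·γ⁻¹) ≠ {1}`, then
`Π_v = γ·Π_v·γ⁻¹`" (proof of (v) p. 16, the hypothesis `hL` of `DPSCData.prop13v_of_inputs`) FOLLOWS
from: graphicity of the conjugation action on verticial subgroups (I-GR, Def 1.2 (ii)); the "in
particular" clause of Prop 1.3 (iv) in its printed `Π_𝔾`-scope, "`I_v ∩ I_{v'} ≠ {1}` implies `v = v'`"
for the `Π_𝔾`-conjugates of `I_{v'}` (second conjunct of `DPSCData.Prop13iv'`); and the SAME statement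
restricted to `γ ∈ Π_𝔾`.  [Graphicity rewrites `g·Π_v·g⁻¹ = γ·Π_{v'}·γ⁻¹`, hence
`g·I_v·g⁻¹ = γ·I_{v'}·γ⁻¹`; (iv′) forces `v' = v`.] [cite: MochizukiAbsTopII2013, Prop 1.3 (v) p.16] -/
theorem inputL_of_graphic
    (hGRv : ∀ (g : X.PiH) (v : X.Vert), ∃ v' : X.Vert, ∃ γ ∈ X.PiG,
      MulAut.conj g • X.vertSub v = MulAut.conj γ • X.vertSub v')
    (hiv : ∀ (v v' : X.Vert) (γ : X.PiH), γ ∈ X.PiG →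
      X.Iv v ⊓ MulAut.conj γ • X.Iv v' ≠ ⊥ → v = v')
    (hLG : ∀ (v : X.Vert) (γ : X.PiH), γ ∈ X.PiG → X.Iv v ⊓ MulAut.conj γ • X.Iv v ≠ ⊥ →
      MulAut.conj γ • X.vertSub v = X.vertSub v) :
    ∀ (v : X.Vert) (g : X.PiH), X.Iv v ⊓ MulAut.conj g • X.Iv v ≠ ⊥ →
      MulAut.conj g • X.vertSub v = X.vertSub v := by
  intro v g hne
  obtain ⟨v', γ, hγ, hgv⟩ := hGRv g v
  rw [X.conj_smul_Iv_eq_of_conj_smul_vertSub_eq hgv] at hne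
  obtain rfl : v = v' := hiv v v' γ hγ hne
  rw [hgv]
  exact hLG v γ hγ hne

/-- The same with the (iv′)-input read BY NAME from the typed row `DPSCData.Prop13iv'` (abc-iut-L4-t4,
`DecompositionGroups.lean` v2, p425881). [cite: MochizukiAbsTopII2013, Prop 1.3 (iv) p.11] -/
theorem inputL_of_graphic_of_prop13iv' (hiv' : X.Prop13iv')
    (hGRv : ∀ (g : X.PiH) (v : X.Vert), ∃ v' : X.Vert, ∃ γ ∈ X.PiG,
      MulAut.conj g • X.vertSub v = MulAut.conj γ • X.vertSub v')
    (hLG : ∀ (v : X.Vert) (γ : X.PiH), γ ∈ X.PiG → X.Iv v ⊓ MulAut.conj γ • X.Iv v ≠ ⊥ →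
      MulAut.conj γ • X.vertSub v = X.vertSub v) :
    ∀ (v : X.Vert) (g : X.PiH), X.Iv v ⊓ MulAut.conj g • X.Iv v ≠ ⊥ →
      MulAut.conj g • X.vertSub v = X.vertSub v :=
  X.inputL_of_graphic hGRv hiv'.2 hLG

/-! ## The `Π_𝔾`-scope statement versus centralisers of inertia elements -/

/-- For `γ ∈ Π_𝔾`: a nontrivial element `y` of `I_v ∩ γ·I_v·γ⁻¹` COMMUTES with `γ` — given
`I_v ∩ Π_𝔾 = {1}` (Prop 1.3 (iii), "we obtain a natural injection `I_v ↪ I`", p. 13): indeed `y` and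
`γ⁻¹·y·γ` both lie in `I_v` and are congruent modulo `Π_𝔾`, hence equal.
[cite: MochizukiAbsTopII2013, Prop 1.3 (iii) p.13] -/
theorem exists_comm_of_Iv_inf_conj_ne_bot (h3 : ∀ v : X.Vert, X.Iv v ⊓ X.PiG = ⊥) {v : X.Vert}
    {γ : X.PiH} (hγ : γ ∈ X.PiG) (hne : X.Iv v ⊓ MulAut.conj γ • X.Iv v ≠ ⊥) :
    ∃ x ∈ X.Iv v, x ≠ 1 ∧ γ * x = x * γ := by
  obtain ⟨⟨y, hy⟩, hy1⟩ := Subgroup.ne_bot_iff_exists_ne_one.mp hne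
  obtain ⟨hyI, hyc⟩ := Subgroup.mem_inf.mp hy
  rw [Subgroup.mem_pointwise_smul_iff_inv_smul_mem, ← map_inv, MulAut.smul_def, MulAut.conj_apply,
    inv_inv] at hyc
  -- `hyc : γ⁻¹ * y * γ ∈ I_v`
  have hq : y * (γ⁻¹ * y * γ)⁻¹ ∈ X.Iv v ⊓ X.PiG := by
    refine Subgroup.mem_inf.mpr ⟨mul_mem hyI (inv_mem hyc), ?_⟩
    have e : y * (γ⁻¹ * y * γ)⁻¹ = y * γ⁻¹ * y⁻¹ * γ := by group
    rw [e]
    exact mul_mem (X.normal_PiG.conj_mem γ⁻¹ (inv_mem hγ) y) hγ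
  rw [h3 v, Subgroup.mem_bot, mul_inv_eq_one] at hq
  refine ⟨y, hyI, fun h => hy1 (Subtype.ext h), ?_⟩
  calc γ * y = γ * (γ⁻¹ * y * γ) := by rw [← hq]
    _ = y * γ := by group

/-- **I-Z ⟹ I-L at `Π_𝔾`-scope.**  If `I_v ∩ Π_𝔾 = {1}` (Prop 1.3 (iii)) and, for every nontrivial
inertia element `x ∈ I_v`, `Z_{Π_𝔾}(x) ⊆ D_v = N_{Π_H}(Π_v)` (I-Z), then for `γ ∈ Π_𝔾`:
`I_v ∩ γ·I_v·γ⁻¹ ≠ {1}` implies `γ·Π_v·γ⁻¹ = Π_v`. [cite: MochizukiAbsTopII2013, Prop 1.3 (v) p.16] -/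
theorem inputLG_of_centralizer_le_Dv (h3 : ∀ v : X.Vert, X.Iv v ⊓ X.PiG = ⊥)
    (hZ : ∀ (v : X.Vert), ∀ x ∈ X.Iv v, x ≠ 1 →
      Subgroup.centralizer ({x} : Set X.PiH) ⊓ X.PiG ≤ X.Dv v) :
    ∀ (v : X.Vert) (γ : X.PiH), γ ∈ X.PiG → X.Iv v ⊓ MulAut.conj γ • X.Iv v ≠ ⊥ →
      MulAut.conj γ • X.vertSub v = X.vertSub v := by
  intro v γ hγ hne
  obtain ⟨x, hx, hx1, hcomm⟩ := X.exists_comm_of_Iv_inf_conj_ne_bot h3 hγ hne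
  have hγD : γ ∈ X.Dv v :=
    hZ v x hx hx1 (Subgroup.mem_inf.mpr ⟨Subgroup.mem_centralizer_singleton_iff.mpr hcomm, hγ⟩)
  exact (mem_normalizer_iff_conj_smul_eq' γ (X.vertSub v)).mp hγD

/-- **I-L at `Π_𝔾`-scope ⟹ I-Z** (no further input): if `γ ∈ Π_𝔾` commutes with `1 ≠ x ∈ I_v`, then
`x ∈ I_v ∩ γ·I_v·γ⁻¹ ≠ {1}`, so `γ·Π_v·γ⁻¹ = Π_v`, i.e. `γ ∈ N_{Π_H}(Π_v) = D_v`.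
[cite: MochizukiAbsTopII2013, Prop 1.3 (v) p.16] -/
theorem centralizer_inf_PiG_le_Dv_of_inputLG
    (hLG : ∀ (v : X.Vert) (γ : X.PiH), γ ∈ X.PiG → X.Iv v ⊓ MulAut.conj γ • X.Iv v ≠ ⊥ →
      MulAut.conj γ • X.vertSub v = X.vertSub v)
    (v : X.Vert) {x : X.PiH} (hx : x ∈ X.Iv v) (hx1 : x ≠ 1) :
    Subgroup.centralizer ({x} : Set X.PiH) ⊓ X.PiG ≤ X.Dv v := by
  intro γ hγ'
  obtain ⟨hγx, hγ⟩ := Subgroup.mem_inf.mp hγ'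
  rw [Subgroup.mem_centralizer_singleton_iff] at hγx
  -- `x ∈ γ·I_v·γ⁻¹` since `γ⁻¹·x·γ = x`
  have hxc : x ∈ MulAut.conj γ • X.Iv v := by
    rw [Subgroup.mem_pointwise_smul_iff_inv_smul_mem, ← map_inv, MulAut.smul_def, MulAut.conj_apply,
      inv_inv]
    have e : γ⁻¹ * x * γ = x := by
      rw [mul_assoc, ← hγx, ← mul_assoc, inv_mul_cancel, one_mul]
    rw [e]
    exact hx
  have hne : X.Iv v ⊓ MulAut.conj γ • X.Iv v ≠ ⊥ := by
    rw [Subgroup.ne_bot_iff_exists_ne_one]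
    exact ⟨⟨x, Subgroup.mem_inf.mpr ⟨hx, hxc⟩⟩, fun h => hx1 (congrArg Subtype.val h)⟩
  exact (mem_normalizer_iff_conj_smul_eq' γ (X.vertSub v)).mpr (hLG v γ hγ hne)

/-- Hence, GIVEN `I_v ∩ Π_𝔾 = {1}`, the `Π_𝔾`-scope form of I-L and the centraliser statement I-Z are
EQUIVALENT. [cite: MochizukiAbsTopII2013, Prop 1.3 (v) p.16] -/
theorem inputLG_iff_centralizer_le_Dv (h3 : ∀ v : X.Vert, X.Iv v ⊓ X.PiG = ⊥) :
    (∀ (v : X.Vert) (γ : X.PiH), γ ∈ X.PiG → X.Iv v ⊓ MulAut.conj γ • X.Iv v ≠ ⊥ →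
      MulAut.conj γ • X.vertSub v = X.vertSub v) ↔
    ∀ (v : X.Vert), ∀ x ∈ X.Iv v, x ≠ 1 →
      Subgroup.centralizer ({x} : Set X.PiH) ⊓ X.PiG ≤ X.Dv v :=
  ⟨fun hLG v _ hx hx1 => X.centralizer_inf_PiG_le_Dv_of_inputLG hLG v hx hx1,
    fun hZ => X.inputLG_of_centralizer_le_Dv h3 hZ⟩

/-- **Row P13/I-L in normal form.**  GIVEN graphicity (I-GR), the `Π_𝔾`-scope "in particular" clause
of (iv) (`Prop13iv'`.2) and `I_v ∩ Π_𝔾 = {1}` ((iii)), the printed `Π_H`-level statement "for `γ ∈ Π_H`,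
`I_v ∩ γ·I_v·γ⁻¹ ≠ {1} ⇒ Π_v = γ·Π_v·γ⁻¹`" is EQUIVALENT to I-Z: "`Z_{Π_𝔾}(x) ⊆ D_v` for every vertex
`v` and every `1 ≠ x ∈ I_v`". [cite: MochizukiAbsTopII2013, Prop 1.3 (v) p.16] -/
theorem inputL_iff_centralizer_le_Dv
    (hGRv : ∀ (g : X.PiH) (v : X.Vert), ∃ v' : X.Vert, ∃ γ ∈ X.PiG,
      MulAut.conj g • X.vertSub v = MulAut.conj γ • X.vertSub v')
    (hiv : ∀ (v v' : X.Vert) (γ : X.PiH), γ ∈ X.PiG →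
      X.Iv v ⊓ MulAut.conj γ • X.Iv v' ≠ ⊥ → v = v')
    (h3 : ∀ v : X.Vert, X.Iv v ⊓ X.PiG = ⊥) :
    (∀ (v : X.Vert) (g : X.PiH), X.Iv v ⊓ MulAut.conj g • X.Iv v ≠ ⊥ →
      MulAut.conj g • X.vertSub v = X.vertSub v) ↔
    ∀ (v : X.Vert), ∀ x ∈ X.Iv v, x ≠ 1 →
      Subgroup.centralizer ({x} : Set X.PiH) ⊓ X.PiG ≤ X.Dv v :=
  ⟨fun hL => (X.inputLG_iff_centralizer_le_Dv h3).mp fun v γ _ => hL v γ,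
    fun hZ => X.inputL_of_graphic hGRv hiv (X.inputLG_of_centralizer_le_Dv h3 hZ)⟩

/-! ## Prop 1.3 (v) with the reduced input -/

/-- **[AbsTopII] Prop 1.3 (v) (F-0278) from the typed (iii) and (iv′), the [CombGC] / graphicity
inputs, the centraliser statement I-Z and `I_v` infinite.**  Hypotheses: `DPSCData.Prop13iii` (F-0275:
`I_v ∩ Π_𝔾 = {1}`, `I_v·Π_𝔾 = Π_I`) and `DPSCData.Prop13iv'` (the printed `Π_𝔾`-scope of (iv)) BY
NAME; graphicity of conjugation on verticial subgroups (Def 1.2 (ii)); [CombGC] Prop 1.2 (i)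
(finite-index form) and (ii) for verticial subgroups; I-Z (`Z_{Π_𝔾}(x) ⊆ D_v` for `1 ≠ x ∈ I_v`);
`I_v` infinite.  Conclusion: literally `DPSCData.Prop13v`. [cite: MochizukiAbsTopII2013, Prop 1.3 (v) p.12] -/
theorem prop13v_of_prop13iii_prop13iv' (hiii : X.Prop13iii) (hiv' : X.Prop13iv')
    (hGRv : ∀ (g : X.PiH) (v : X.Vert), ∃ v' : X.Vert, ∃ γ ∈ X.PiG,
      MulAut.conj g • X.vertSub v = MulAut.conj γ • X.vertSub v')
    (hDetv : ∀ (v v' : X.Vert) (γ : X.PiH), γ ∈ X.PiG →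
      (MulAut.conj γ • X.vertSub v' ⊓ X.vertSub v).relIndex (X.vertSub v) ≠ 0 → v' = v)
    (hCTv : ∀ v : X.Vert, IsCommensurablyTerminal ((X.vertSub v).subgroupOf X.PiG))
    (hZ : ∀ (v : X.Vert), ∀ x ∈ X.Iv v, x ≠ 1 →
      Subgroup.centralizer ({x} : Set X.PiH) ⊓ X.PiG ≤ X.Dv v)
    (hinf : ∀ v : X.Vert, Infinite ↥(X.Iv v)) : X.Prop13v :=
  X.prop13v_of_inputs hGRv hDetv hCTv
    (X.inputL_of_graphic hGRv hiv'.2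
      (X.inputLG_of_centralizer_le_Dv (fun v => (hiii v).1) hZ)) hinf

end DPSCData

namespace AbsTopII.DPSCIndexData

variable (X : DPSCIndexData.{u})

/-- **[AbsTopII] Prop 1.3 (v) (F-0278) at `Σ`-indexed DPSC data**, with "`I_v` infinite" read from the
typed Prop 1.3 (iii) `Prop_1_3_iii'` (F-0299: `I_v ≅ Ẑ^Σ`) and `I_v ∩ Π_𝔾 = {1}` from `Prop13iii`
(F-0275); remaining inputs: graphicity, [CombGC] Prop 1.2 (i)(ii), `Prop13iv'`, I-Z.
[cite: MochizukiAbsTopII2013, Prop 1.3 (v) p.12] -/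
theorem prop13v_of_prop_1_3_iii'_prop13iv' (hiii' : X.Prop_1_3_iii') (hiii : X.Prop13iii)
    (hiv' : X.Prop13iv')
    (hGRv : ∀ (g : X.PiH) (v : X.Vert), ∃ v' : X.Vert, ∃ γ ∈ X.PiG,
      MulAut.conj g • X.vertSub v = MulAut.conj γ • X.vertSub v')
    (hDetv : ∀ (v v' : X.Vert) (γ : X.PiH), γ ∈ X.PiG →
      (MulAut.conj γ • X.vertSub v' ⊓ X.vertSub v).relIndex (X.vertSub v) ≠ 0 → v' = v)
    (hCTv : ∀ v : X.Vert, IsCommensurablyTerminal ((X.vertSub v).subgroupOf X.PiG))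
    (hZ : ∀ (v : X.Vert), ∀ x ∈ X.Iv v, x ≠ 1 →
      Subgroup.centralizer ({x} : Set X.PiH) ⊓ X.PiG ≤ X.Dv v) : X.Prop13v :=
  X.toDPSCData.prop13v_of_prop13iii_prop13iv' hiii hiv' hGRv hDetv hCTv hZ
    (X.infinite_Iv_of_prop_1_3_iii' hiii')

end AbsTopII.DPSCIndexData

end Literature.AnabelianGeometry.AbsoluteAnabelian
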